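import Literature.Analysis.FluidPDE.NSVorticity
import Literature.Analysis.FluidPDE.LerayHopfProofs
import HarnessLib

/-!
# Chae–Wolf 2021: the almost-Serrin criterion on ONE velocity component
# (`u₃ ∈ L^p_t L^q_x`, `2/p + 3/q < 1`), Theorem 1.2 — named fact

Topic `Analysis/FluidPDE`, file of one NAMED FACT (`def … : Prop`, D-0014) with a proved special
case. Typed (statements first, D-0064) for the N0 one-velocity-component door of cell
`ns-regularity-ideate`, `Summit.NavierStokesRegularity.NavierStokesRegularity.Theses.LocalVelCompTubeDoor`
(leaf: one Cartesian component `√(T−t) ⟪u, e⟫` fading on one similarity window under local Type I;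
crux K2′ `VelCompWindowRigidity`), whose thesis lists the printed one-velocity-component
REGULARITY CRITERIA as comparators: "Chae–Wolf arXiv:1911.02699 … needs `2/p + 3/q < 1`";
also named by `….Theses.OneComponentPincer` and `….Theses.TypeIIInviscidRelaxation`. Its
neighbours in the tree: `KangNguyen2022_oneComponent_epsReg` (Kang–Nguyen 2022 Thm 1.3, one
small component at one scale, fact), `kukavicaRusinZiane2017_oneComponent_smallness` (fact),
`oneComponentGradientCriterion` (`∇u₃`, PROVED), `baeChoe_two_velocity_components_criterion`
(two components in the Prodi–Serrin class, PROVED).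

## Source

D. Chae, J. Wolf, *On the Serrin-type condition on one velocity component for the Navier–Stokes
equations*, Arch. Ration. Mech. Anal. **240** (2021) 1323–1347 = arXiv:1911.02699 [ChaeWolf2021]
(held: lit key `paper:arxiv-1911.02699`; theorem numbering and pages of the arXiv version).
§1 (p. 2): (NS) `∂ₜu + (u·∇)u − Δu = −∇π`, `∇·u = 0` in `ℝ³ × (0,T)` (viscosity `1`); p. 3:
`V^{1,2}(Ω_T) = L^∞(0,T; L²(Ω)) ∩ L²(0,T; W^{1,2}(Ω))`, `V^{1,2}_{0,σ}` its solenoidal part;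
`L^p(a,b; X)` for `1 ≤ p ≤ +∞`.

**Theorem 1.2** (arXiv p. 4, verbatim). "Let `u₀ ∈ L²_σ(ℝ³) ∩ L³(ℝ³)`. Let
`u ∈ V^{1,2}_{0,σ}(ℝ³ × (0,T))` be a weak Leray solution to (1.1), (1.2). Suppose the following
almost Serrin condition for one velocity component holds: `u₃ ∈ L^p(0,T; L^q(ℝ³))` for some
`3 < q ≤ +∞` with `2/p + 3/q < 1`. Then, `u` is a regular solution."

Its proof (§2, arXiv p. 5): with `T_*` the maximal time of the `L³`-strong (Kato) solution from
`u₀`, "Assume `0 < T_* ≤ T` … condition (1.8) of Theorem 1.3 is fulfilled [Hölder in time, using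
the STRICT inequality for the logarithmic factor]. This implies that `(x₀, T_*)` is a regular
point. In particular, `u ∈ L^∞(0,T_*; L³(ℝ³))` which contradicts to the definition of `T_*`" —
so "regular solution" means `T_* > T`: the strong solution lives past `T`.

## Rendering (the tree's continuation frame, ns.S27 — verbatim that of the PROVED neighbours
`baeChoe_two_velocity_components_criterion`, `chaeChoe_two_vorticity_components_criterion`)

* `(u, p)` a classical unforced solution on `ℝ³ × [0,T)` (`IsClassicalNSSolutionOn (Ico 0 T) ν 0 u p`)
  in the Beale–Kato–Majda class on every `[0,T'']`, `T'' < T`. Its datum `u 0 ∈ ⋂ₙ Hⁿ ⊂ L² ∩ L³`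
  is divergence free and `u` is a weak Leray solution in `V^{1,2}_{0,σ}(ℝ³ × (0,T))` (energy
  equality on every `[0,T'']`, hence `u ∈ L^∞(0,T;L²) ∩ L²(0,T;H¹)`), so the printed
  hypotheses hold for the rendered class.
* Hypothesis: `MemLqLp a b (u·e₃) (Ioo 0 T)` with `2/a + 3/b < 1` and `3 < b` (`b = ⊤`
  allowed; `a = ⊤` allowed, as printed: `1 ≤ p ≤ +∞`); `u₃` is the Cartesian component of
  index `2 : Fin 3` (the paper's fixed frame; no rotation is performed).
* Conclusion: continuation in the class past `T` (`HasSobolevExtensionPast ν u T`) — what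
  `T_* > T` gives for the rendered class (the `L³`-strong solution from the smooth datum `u 0`
  is the classical solution, smooth with bounded Sobolev norms on `[0,T] ⊂ [0,T_*)`, and agrees
  with `u` on `[0,T)`). So the `def` below is implied by print.
* Viscosity: printed for `ν = 1`; stated for every `ν > 0` — the same statement under the scaling
  `v(s,y) = ν⁻¹u(s/ν, y)` (the convention of every criterion in this directory).

## What is NOT here

The local Theorem 1.3 / Corollary 1.5 (suitable weak solutions, anisotropic cylinders
`U(x₀; ρ, r) × (t₀ − r², t₀)`, the logarithmic condition (1.8)) and the proof (§§2–3). The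
ENDPOINT `2/p + 3/q = 1` for `u₃ ∈ L^p_tL^q_x` is OPEN in print (Wang–Wu–Zhang, Ann. Inst. H.
Poincaré C (2023) doi:10.4171/aihpc/77, Remark (2): "the regularity of the weak solution under
the condition `u₃ ∈ L^q(0,T;L^p(ℝ³))` with `2/q + 3/p = 1` is still open"; they prove it in the
time-Lorentz class `L^{q,1}_t L^p_x`) — it is NOT asserted anywhere in this file. The Type-I
one-component criterion of Bae–Kang 2019 (Appl. Math. Lett. 94; paywalled, acquisition
acq-09211) is not vendored: its only held restatement (Kang–Nguyen arXiv:2206.02490 Remark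
1.1(4): "smooth bounded solutions … do not blow up at `t = 0` if `‖v(t)‖_∞ ≤ C/√(−t)` and
`v₃ ∈ L^p(−1,0;L^q)`, `2/p + 3/q = 1`") omits the solution class, without which the sentence is
false (`v = c(−t)^{−1/2} e₁`, `π = −∂ₜv·x` is smooth, Type I, has `v₃ ≡ 0` and blows up).

## References

* D. Chae, J. Wolf, Arch. Ration. Mech. Anal. 240 (2021) 1323–1347 = arXiv:1911.02699, §1
  Thm. 1.2 (p. 4), §2 (p. 5). [ChaeWolf2021]
* K. Kang, D. D. Nguyen, J. Math. Fluid Mech. 25 (2023) = arXiv:2206.02490, §1 and Remark 1.1.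
  [KangNguyen2022]
* W. Wang, D. Wu, Z. Zhang, Ann. Inst. H. Poincaré Anal. Non Linéaire (2023),
  doi:10.4171/aihpc/77, Thm. 1.1 and Remarks (2)–(3). [WangWuZhang2023]
* J. Serrin, in *Nonlinear Problems* (1963), §3 (mixed classes). [Serrin1963]
-/

noncomputable section

open MeasureTheory Set Function Filter
open _root_.Topology
open scoped ENNReal NNReal

namespace Literature.Analysis.FluidPDE

/-- **Chae–Wolf 2021, Theorem 1.2** (Arch. Ration. Mech. Anal. 240 (2021) = arXiv:1911.02699,
p. 4: "Let `u₀ ∈ L²_σ(ℝ³) ∩ L³(ℝ³)`. Let `u ∈ V^{1,2}_{0,σ}(ℝ³ × (0,T))` be a weak Leray solution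
… Suppose … `u₃ ∈ L^p(0,T; L^q(ℝ³))` for some `3 < q ≤ +∞` with `2/p + 3/q < 1`. Then, `u` is
a regular solution." — i.e. the `L³`-strong solution lives past `T`, proof p. 5), in the tree's
continuation frame (module docstring; that of `baeChoe_two_velocity_components_criterion`): for
`ν > 0`, `T > 0` and a classical unforced solution `(u, p)` on `ℝ³ × [0,T)` in the
Beale–Kato–Majda class on every `[0,T'']`, `T'' < T`, if the third velocity component
`u₃ = u · e₃` lies in `L^a(0,T; L^b(ℝ³))` with `2/a + 3/b < 1` and `3 < b ≤ ∞` (`a = ∞`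
allowed), then `u` continues in the class past `T`. Statement only; users take
`(h : chaeWolf2021_oneComponent_almostSerrin_criterion)`. [cite: ChaeWolf2021, Thm. 1.2 (arXiv:1911.02699 §1 p. 4; proof §2 p. 5)] -/
def chaeWolf2021_oneComponent_almostSerrin_criterion : Prop :=
  ∀ ⦃ν : ℝ⦄, 0 < ν → ∀ ⦃T : ℝ⦄, 0 < T →
    ∀ ⦃u : ℝ → EuclideanSpace ℝ (Fin 3) → EuclideanSpace ℝ (Fin 3)⦄
      ⦃p : ℝ → EuclideanSpace ℝ (Fin 3) → ℝ⦄,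
      IsClassicalNSSolutionOn (Ico 0 T) ν 0 u p →
      (∀ T'' < T, HasBoundedSobolevNormsOn (Icc 0 T'') u) →
      ∀ ⦃a b : ℝ≥0∞⦄,
        -- `u₃ ∈ L^a(0,T; L^b(ℝ³))`, `2/a + 3/b < 1`, `3 < b ≤ ∞`
        2 / a + 3 / b < 1 → 3 < b → MemLqLp a b (fun t x => u t x 2) (Ioo 0 T) →
      HasSobolevExtensionPast ν u T

/-- The exponent pair `(a, b) = (∞, ∞)` satisfies the almost-Serrin condition `2/a + 3/b < 1`
(`2/∞ = 3/∞ = 0`): the printed range `3 < q ≤ +∞`, `1 ≤ p ≤ +∞` of Chae–Wolf 2021 Thm. 1.2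
includes `u₃ ∈ L^∞(0,T; L^∞(ℝ³))`. [cite: ChaeWolf2021, Thm. 1.2 (arXiv:1911.02699 p. 4)] -/
theorem chaeWolf2021_exponents_top : (2 : ℝ≥0∞) / ⊤ + 3 / ⊤ < 1 := by
  rw [ENNReal.div_top, ENNReal.div_top, add_zero]
  exact zero_lt_one

/-- **Special case of Chae–Wolf 2021, Theorem 1.2** (`q = p = ∞`): a classical solution of the
frame whose third velocity component vanishes for a.e. `t ∈ (0,T)` and a.e. `x` continues past
`T` — the instance `(a,b) = (∞,∞)` of the fact, the zero slices lying in every mixed class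
(conditional on the fact; the form in which the one-velocity-component door K2′ of cell
`ns-regularity-ideate`, "`v · e ≡ 0`", meets the printed criterion). [cite: ChaeWolf2021, Thm. 1.2 (arXiv:1911.02699 p. 4)] -/
theorem chaeWolf2021_oneComponent_almostSerrin_criterion.of_ae_eq_zero
    (h : chaeWolf2021_oneComponent_almostSerrin_criterion) {ν : ℝ} (hν : 0 < ν) {T : ℝ}
    (hT : 0 < T) {u : ℝ → EuclideanSpace ℝ (Fin 3) → EuclideanSpace ℝ (Fin 3)}
    {p : ℝ → EuclideanSpace ℝ (Fin 3) → ℝ}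
    (hsol : IsClassicalNSSolutionOn (Ico 0 T) ν 0 u p)
    (hreg : ∀ T'' < T, HasBoundedSobolevNormsOn (Icc 0 T'') u)
    (hu : ∀ᵐ t ∂(volume.restrict (Ioo 0 T)), (fun x => u t x 2) =ᵐ[volume] 0) :
    HasSobolevExtensionPast ν u T :=
  h hν hT hsol hreg chaeWolf2021_exponents_top ENNReal.ofNat_lt_top
    (memLqLp_of_ae_slice_eq_zero hu)

end Literature.Analysis.FluidPDE

end
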